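import Mathlib
import HarnessLib
import Summits.ValiantsHypothesis.ValiantsHypothesis.Theses.MonotoneRestoration
import Literature.Computability.AlgebraicComplexity.ArithCircuit
import Literature.Computability.AlgebraicComplexity.ArithCircuitProofs
import Literature.Computability.AlgebraicComplexity.MonotoneStructure
import Literature.Computability.AlgebraicComplexity.PermanentIrreducible
import Literature.ModelTheory.FiniteModelTheory.CkEquiv
import Summits.ValiantsHypothesis.ValiantsHypothesis.Theorems.MonotoneRestorationMonotoneRestorationQPCosetCount
import Summits.ValiantsHypothesis.ValiantsHypothesis.Theorems.MonotoneRestorationMonotoneRestorationQPSymmetricLB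
import Summits.ValiantsHypothesis.ValiantsHypothesis.Theorems.MonotoneRestorationMonotoneRestorationQPSupportSymmetrisation
import Summits.ValiantsHypothesis.ValiantsHypothesis.Theorems.MonotoneRestorationMonotoneRestorationQPSparseRegime
import Summits.ValiantsHypothesis.ValiantsHypothesis.Theorems.MonotoneRestorationMonotoneRestorationQPBeta
import Literature.Computability.AlgebraicComplexity.SymmetricArithCircuit
import Literature.Computability.AlgebraicComplexity.DawarWilsenach2025Proofs
import Literature.GroupTheory.PermutationGroups.SmallIndexSubgroups
import Summits.ValiantsHypothesis.ValiantsHypothesis.Theorems.MonotoneRestorationQP.Negative.LoadBearing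
import Summits.ValiantsHypothesis.ValiantsHypothesis.Theorems.MonotoneRestorationMonotoneRestorationQPPermSupportCount
import Summits.ValiantsHypothesis.ValiantsHypothesis.Theorems.MonotoneRestorationMonotoneRestorationQPMonotoneComputationOfComplexity

/-! TTRL-lite variant V19023 of stmt-ValiantsHypothesis-15886

Variant V19023 (`small_case`: `complexity f ≤ 2 → size ≤ 6`) of the stub
`stub_monotoneComputation_of_complexity` of line c2 of the crux `MonotoneRestorationQP`: over `ℝ≥0`,
every polynomial of weighted fan-in-two complexity at most `2` has a Jerrum–Snir monotone
computation (plain fan-in-two circuit, `IsMonotoneComputation`) with at most `6` gates.  The parent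
statement (size `≤ 3 · complexity f`, every `σ : Type`) is in the tree as
`Summit.ValiantsHypothesis.ValiantsHypothesis.Theorems.stub_monotoneComputation_of_complexity`
(`Theorems/MonotoneRestorationMonotoneRestorationQPMonotoneComputationOfComplexity.lean`: each weighted
gate `c • u + d • v` of a size-optimal circuit becomes the three plain gates `(c ⊗ u), (d ⊗ v), ⊕` of
`Plainify.circuit`); the variant is its two-gate rung `3 · 2 = 6`.
-/

-- `ValiantsHypothesis.ValiantsHypothesis`: the D-0017 layout repeats the problem name in the path.
set_option linter.dupNamespace false

namespace Summit.ValiantsHypothesis.ValiantsHypothesis.Theorems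

open Summit.ValiantsHypothesis.ValiantsHypothesis.Theses.MonotoneRestoration
open Literature.Computability.AlgebraicComplexity

/-- **TTRL-lite variant V19023** (`small_case`, two-gate rung) of
`stub_monotoneComputation_of_complexity` (stmt-ValiantsHypothesis-15886): over `ℝ≥0`, every `f` with
`complexity f ≤ 2` has a Jerrum–Snir monotone computation with at most `6` gates — the landed parent
stub gives one of size `≤ 3 · complexity f ≤ 3 · 2 = 6`. [cite: JerrumSnir1982, §2.2] -/
theorem stub_monotoneComputation_of_complexity_var19023 :
    ∀ (σ : Type) (f : MvPolynomial σ NNReal), complexity f ≤ 2 → ∃ P : ArithCircuit NNReal σ,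
      Literature.Barriers.ValiantsHypothesis.IsMonotoneComputation P f ∧ P.size ≤ 6 := by
  intro σ f hf
  obtain ⟨P, hP, hs⟩ := stub_monotoneComputation_of_complexity f
  exact ⟨P, hP, by omega⟩

end Summit.ValiantsHypothesis.ValiantsHypothesis.Theorems
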